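import Summits.AnomalousDissipation.AnomalousDissipation.Theorems.SawtoothPulseCascadeK1LocalisedCascadeFibreWindow
import Summits.AnomalousDissipation.AnomalousDissipation.Theorems.SawtoothPulseCascadeK1LocalisedCascadePhaseOneModes

/-!
# K1loc, line `Spectral` / thin start — helper: SUP NORM OF A FIBRE COEFFICIENT ≤ ℓ¹ NORM OF ITS SLAB (S-D step, fibre-`L²` road)

Helper file of the prover lane on the crux `K1LocalisedCascade` (stmt-AnomalousDissipation-19491), route `SawtoothPulseCascade`
(S-B/S-C assembly seat; input `S_n` of `…FibreWindowL2.sum_window_sq_norm_comp_shearMap_le_fibreL2`).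
* §1 `norm_twistedAxisAvg_le_tsum_slab`: for a continuous `v` with absolutely summable coefficients and every `x`,
  `‖A^i_m v(x)‖ = ‖∫e_{−m}(s)v(x + se_i)ds‖ ≤ Σ'_k [k_i = m]‖𝓕v(k)‖` (the fibre component is the absolutely convergent Fourier series
  over its slab, `…StripBlock.mFourierCoeff_twistedAxisAvg`);
* §2 `norm_twistedAxisAvg_phaseOne_le`: for the phase-one iterate `a₁` (profile `ψ`), along the `H`-fibres (`i = 0`, `m = k₀`):
  the slab bound applies with `…PhaseOneModes.mFourierCoeff_phaseOne`; along the `V`-fibres of `b₀` the two-mode bound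
  `‖A¹_n b₀(x)‖ ≤ ½(‖ĝ₁(n)‖ + ‖ĝ_{−1}(n)‖)` (`norm_twistedAxisAvg_hstep_datum_le`) — the equidistribution input `C_eq = 2` of phase 1.
No definitions; nothing about the crux. [cite: Grafakos2014, Prop. 3.1.2 (5) and Prop. 3.2.7 (3)] [problem: turb]
-/

-- `Summit.<Summit>.<Problem>`: single-conjunct summit, the duplicate namespace segment is deliberate.
set_option linter.dupNamespace false

noncomputable section

namespace Summit.AnomalousDissipation.AnomalousDissipation.Theorems.SawtoothPulseCascade.K1Start

open MeasureTheory Set Filter Topology UnitAddTorus Function Complex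
open Literature.Analysis Literature.Analysis.FunctionSpaces Literature.Analysis.FunctionSpaces.Torus Literature.Analysis.FluidPDE
open Literature.Analysis.FluidPDE.SawtoothCascade
open Summit.AnomalousDissipation.AnomalousDissipation.Theorems.SawtoothPulseCascade.K1Window

variable {d : Type*} [Fintype d] [DecidableEq d]

/-! ## §1 Sup norm of a fibre coefficient -/

/-- **A fibre coefficient is bounded by the `ℓ¹` norm of its slab**: for continuous `v` with `Σ‖𝓕v‖ < ∞`,
`‖∫e_{−m}(s)v(x + se_i)ds‖ ≤ Σ'_k [k_i = m]‖𝓕v(k)‖` for every `x`. [cite: Grafakos2014, Prop. 3.1.2 (5)] -/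
theorem norm_twistedAxisAvg_le_tsum_slab {v : UnitAddTorus d → ℂ} (hv : Continuous v)
    (hvs : Summable fun k => ‖mFourierCoeff v k‖) (i : d) (m : ℤ) (x : UnitAddTorus d) :
    ‖∫ s : UnitAddCircle, (fourier (-m) s : ℂ) • v (x + Pi.single i s)‖ ≤
      ∑' k : d → ℤ, if k i = m then ‖mFourierCoeff v k‖ else 0 := by
  classical
  set A : UnitAddTorus d → ℂ := fun x => ∫ s : UnitAddCircle, (fourier (-m) s : ℂ) • v (x + Pi.single i s) with hA
  have hAc : Continuous A := continuous_twistedAxisAvg hv i m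
  set F : C(UnitAddTorus d, ℂ) := ⟨A, hAc⟩ with hF
  have hFA : (F : UnitAddTorus d → ℂ) = A := rfl
  have hsn : Summable fun k => ‖mFourierCoeff (F : UnitAddTorus d → ℂ) k‖ := by
    rw [hFA]; exact summable_norm_mFourierCoeff_twistedAxisAvg hv hvs i m
  have hs : Summable (mFourierCoeff (F : UnitAddTorus d → ℂ)) := .of_norm hsn
  have hser := hasSum_mFourier_series_apply_of_summable hs x
  have hcoef : ∀ k, ‖mFourierCoeff (F : UnitAddTorus d → ℂ) k • mFourier k x‖ ≤ if k i = m then ‖mFourierCoeff v k‖ else 0 := by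
    intro k
    rw [hFA, hA, norm_smul, mFourierCoeff_twistedAxisAvg hv i m k]
    have h1 : ‖mFourier k x‖ ≤ 1 := ((mFourier k).norm_coe_le_norm x).trans_eq mFourier_norm
    split_ifs
    · exact (mul_le_mul_of_nonneg_left h1 (norm_nonneg _)).trans_eq (mul_one _)
    · simp
  have hsI : Summable fun k : d → ℤ => if k i = m then ‖mFourierCoeff v k‖ else 0 :=
    Summable.of_nonneg_of_le (fun k => by split_ifs <;> positivity)
      (fun k => by split_ifs <;> simp [norm_nonneg]) hvs
  have hsN : Summable fun k => ‖mFourierCoeff (F : UnitAddTorus d → ℂ) k • mFourier k x‖ :=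
    Summable.of_nonneg_of_le (fun k => norm_nonneg _) hcoef hsI
  calc ‖A x‖ = ‖∑' k, mFourierCoeff (F : UnitAddTorus d → ℂ) k • mFourier k x‖ := by rw [hser.tsum_eq]; rfl
    _ ≤ ∑' k, ‖mFourierCoeff (F : UnitAddTorus d → ℂ) k • mFourier k x‖ := norm_tsum_le_tsum_norm hsN
    _ ≤ ∑' k, if k i = m then ‖mFourierCoeff v k‖ else 0 := Summable.tsum_le_tsum hcoef hsN hsI

/-! ## §2 The phase-one iterate along the `H`-fibres and `b₀` along the `V`-fibres -/

/-- **The `V`-fibre coefficients of `b₀ = datum ∘ Φ_H` are two-mode**: for every `n` and `x`,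
`‖A¹_n b₀(x)‖ ≤ ½(‖ĝ₁(n)‖ + ‖ĝ_{−1}(n)‖)` (the slab `k₁ = n` of `𝓕b₀` consists of the two modes `(±1, n)` with coefficients
`(∓I/2)ĝ_{±1}(n)`). [cite: Grafakos2014, Prop. 3.1.2 (5)] -/
theorem norm_twistedAxisAvg_hstep_datum_le (ψ : ShearProfile) (n : ℤ) (x : UnitAddTorus (Fin 2)) :
    ‖∫ s : UnitAddCircle, (fourier (-n) s : ℂ) • (((datum ∘ shearMap 0 1 ψ) (x + Pi.single (1 : Fin 2) s) : ℝ) : ℂ)‖ ≤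
      1 / 2 * (‖fourierCoeff (twist ψ 1) n‖ + ‖fourierCoeff (twist ψ (-1)) n‖) := by
  classical
  have hbs : IsSmooth (datum ∘ shearMap 0 1 ψ) := isSmooth_datum_comp_shearMap ψ
  have hc : Continuous fun x => (((datum ∘ shearMap 0 1 ψ) x : ℝ) : ℂ) := continuous_ofReal.comp hbs.continuous
  have hs : Summable fun k => ‖mFourierCoeff (fun x => (((datum ∘ shearMap 0 1 ψ) x : ℝ) : ℂ)) k‖ :=
    summable_norm_mFourierCoeff_ofReal_of_isSmooth hbs
  refine (norm_twistedAxisAvg_le_tsum_slab hc hs 1 n x).trans ?_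
  -- the slab `k₁ = n` sum has the two terms `k = (1, n)` and `k = (−1, n)`
  have hval : ∀ k : Fin 2 → ℤ, (if k 1 = n then ‖mFourierCoeff (fun x => (((datum ∘ shearMap 0 1 ψ) x : ℝ) : ℂ)) k‖ else 0) =
      if k = ![1, n] then 1 / 2 * ‖fourierCoeff (twist ψ 1) n‖
      else if k = ![-1, n] then 1 / 2 * ‖fourierCoeff (twist ψ (-1)) n‖ else 0 := by
    intro k
    by_cases hk : k 1 = n
    · rw [if_pos hk, mFourierCoeff_datum_comp_shearMap, mFourierCoeff_datum_single, hk, norm_mul]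
      by_cases h1 : k 0 = 1
      · have hk' : k = ![1, n] := by ext i; fin_cases i <;> simp [h1, hk]
        rw [if_pos hk', h1]; simp; ring
      · by_cases h2 : k 0 = -1
        · have hk' : k = ![-1, n] := by ext i; fin_cases i <;> simp [h2, hk]
          have hne : k ≠ ![1, n] := by intro h; rw [h] at h1; simp at h1
          rw [if_neg hne, if_pos hk', h2]; simp; ring
        · have hne1 : k ≠ ![1, n] := by intro h; rw [h] at h1; simp at h1
          have hne2 : k ≠ ![-1, n] := by intro h; rw [h] at h2; simp at h2
          rw [if_neg hne1, if_neg hne2, if_neg h2, if_neg h1]; simp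
    · rw [if_neg hk]
      have hne1 : k ≠ ![1, n] := by intro h; rw [h] at hk; simp at hk
      have hne2 : k ≠ ![-1, n] := by intro h; rw [h] at hk; simp at hk
      rw [if_neg hne1, if_neg hne2]
  simp_rw [hval]
  have hne : (![1, n] : Fin 2 → ℤ) ≠ ![-1, n] := by intro h; have := congrFun h 0; simp at this
  rw [tsum_eq_sum (s := {![1, n], ![-1, n]}) (fun k hk => by
    rw [Finset.mem_insert, Finset.mem_singleton, not_or] at hk; rw [if_neg hk.1, if_neg hk.2]),
    Finset.sum_pair hne]
  simp [hne.symm]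
  ring_nf
  rfl

/-! ## §3 The phase-one iterate along the `H`-fibres -/

/-- `‖ĝ_n(p)‖ ≤ 1`: a Fourier coefficient of the unimodular chirp `g_n = e_{−n} ∘ ψ`. [cite: Grafakos2014, Prop. 3.2.7 (3)] -/
theorem norm_fourierCoeff_twist_le_one (ψ : ShearProfile) (n p : ℤ) : ‖fourierCoeff (twist ψ n) p‖ ≤ 1 := by
  have h := le_hasSum (hasSum_sq_norm_fourierCoeff_twist ψ n) p fun j _ => sq_nonneg _
  exact (pow_le_one_iff_of_nonneg (norm_nonneg _) two_ne_zero).1 h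

/-- The chirps `g_{±1} = e_{∓1} ∘ ψ` have absolutely summable Fourier coefficients: they are the `k₀ = ±1` fibres of the
smooth field `datum ∘ Φ_H`, whose coefficients are absolutely summable. [cite: Grafakos2014, Prop. 3.1.2 (5)] -/
theorem summable_norm_fourierCoeff_twist_unit (ψ : ShearProfile) {n : ℤ} (hn : n = 1 ∨ n = -1) :
    Summable fun l : ℤ => ‖fourierCoeff (twist ψ n) l‖ := by
  classical
  have hbs : IsSmooth (datum ∘ shearMap 0 1 ψ) := isSmooth_datum_comp_shearMap ψ
  have hs : Summable fun k => ‖mFourierCoeff (fun x => (((datum ∘ shearMap 0 1 ψ) x : ℝ) : ℂ)) k‖ :=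
    summable_norm_mFourierCoeff_ofReal_of_isSmooth hbs
  have hinj : Function.Injective fun l : ℤ => (![n, l] : Fin 2 → ℤ) := by
    intro l l' h; have := congrFun h 1; simpa using this
  have h2 := hs.comp_injective hinj
  have hval : ∀ l : ℤ, ‖mFourierCoeff (fun x => (((datum ∘ shearMap 0 1 ψ) x : ℝ) : ℂ)) ![n, l]‖ =
      1 / 2 * ‖fourierCoeff (twist ψ n) l‖ := by
    intro l
    rw [mFourierCoeff_datum_comp_shearMap, mFourierCoeff_datum_single, norm_mul]
    rcases hn with rfl | rfl <;> simp [mul_comm]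
  have h3 : Summable fun l : ℤ => 1 / 2 * ‖fourierCoeff (twist ψ n) l‖ :=
    h2.congr fun l => by simpa using hval l
  simpa using h3.mul_left 2

/-- **`H`-fibre coefficients of the phase-one iterate**: for `b₀ = datum ∘ Φ_H`, `a₁ = b₀ ∘ Φ_V` (profile `ψ`) and every
horizontal frequency `m` and point `x`,
`‖A⁰_m a₁(x)‖ ≤ ½·Σ'_l (‖ĝ_l(m+1)‖·‖ĝ_{−1}(l)‖ + ‖ĝ_l(m−1)‖·‖ĝ₁(l)‖)` — the slab `k₀ = m` of `𝓕a₁` summed in `ℓ¹` through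
`…PhaseOneModes.mFourierCoeff_phaseOne`.  This is the input `S_m` of `…FibreWindowL2` for the `H` half-step of phase 1; it is small
off the bulk `|m| ≈ γ²` (both chirp factors are sideband values there). [cite: Grafakos2014, Prop. 3.1.2 (5)] -/
theorem norm_twistedAxisAvg_phaseOne_le (ψ : ShearProfile) {b a : UnitAddTorus (Fin 2) → ℝ}
    (hb : b = datum ∘ shearMap 0 1 ψ) (ha : a = b ∘ shearMap 1 0 ψ) (m : ℤ) (x : UnitAddTorus (Fin 2)) :
    ‖∫ s : UnitAddCircle, (fourier (-m) s : ℂ) • ((a (x + Pi.single (0 : Fin 2) s) : ℝ) : ℂ)‖ ≤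
      1 / 2 * ∑' l : ℤ, (‖fourierCoeff (twist ψ l) (m + 1)‖ * ‖fourierCoeff (twist ψ (-1)) l‖ +
        ‖fourierCoeff (twist ψ l) (m - 1)‖ * ‖fourierCoeff (twist ψ 1) l‖) := by
  classical
  have has : IsSmooth a := by rw [ha, hb]; exact (isSmooth_datum_comp_shearMap ψ).comp_shearMap 1 0 ψ
  have hc : Continuous fun x => ((a x : ℝ) : ℂ) := continuous_ofReal.comp has.continuous
  have hs : Summable fun k => ‖mFourierCoeff (fun x => ((a x : ℝ) : ℂ)) k‖ := summable_norm_mFourierCoeff_ofReal_of_isSmooth has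
  refine (norm_twistedAxisAvg_le_tsum_slab hc hs 0 m x).trans ?_
  set R : ℤ → ℝ := fun l => ‖fourierCoeff (twist ψ l) (m + 1)‖ * ‖fourierCoeff (twist ψ (-1)) l‖ +
    ‖fourierCoeff (twist ψ l) (m - 1)‖ * ‖fourierCoeff (twist ψ 1) l‖ with hR
  have hR0 : ∀ l, 0 ≤ R l := fun l => by positivity
  have hRs : Summable R := by
    refine Summable.of_nonneg_of_le hR0 (fun l => ?_)
      ((summable_norm_fourierCoeff_twist_unit ψ (Or.inr rfl)).add (summable_norm_fourierCoeff_twist_unit ψ (Or.inl rfl)))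
    have h1 := norm_fourierCoeff_twist_le_one ψ l (m + 1)
    have h2 := norm_fourierCoeff_twist_le_one ψ l (m - 1)
    have h3 := norm_nonneg (fourierCoeff (twist ψ (-1)) l)
    have h4 := norm_nonneg (fourierCoeff (twist ψ 1) l)
    simp only [hR]
    nlinarith
  -- the coefficient on the slab: `‖𝓕a₁(m, l)‖ ≤ ½ R l`
  have hcomp : (fun x => ((a x : ℝ) : ℂ)) = fun x => (((b ∘ shearMap 1 0 ψ) x : ℝ) : ℂ) := by rw [ha]
  have hpt : ∀ l : ℤ, ‖mFourierCoeff (fun x => ((a x : ℝ) : ℂ)) ![m, l]‖ ≤ 1 / 2 * R l := by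
    intro l
    rw [hcomp, mFourierCoeff_phaseOne ψ hb, norm_mul]
    have hI : ‖(I / 2 : ℂ)‖ = 1 / 2 := by simp
    rw [hI]
    refine mul_le_mul_of_nonneg_left ((norm_sub_le _ _).trans ?_) (by norm_num)
    rw [norm_mul, norm_mul]
    simp [hR]
  -- reindex the slab sum by `l ↦ (m, l)`
  have hinj : Function.Injective fun l : ℤ => (![m, l] : Fin 2 → ℤ) := by
    intro l l' h; have := congrFun h 1; simpa using this
  have hsupp : Function.support (fun k : Fin 2 → ℤ => if k 0 = m then ‖mFourierCoeff (fun x => ((a x : ℝ) : ℂ)) k‖ else 0) ⊆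
      Set.range fun l : ℤ => (![m, l] : Fin 2 → ℤ) := by
    intro k hk
    rw [Function.mem_support] at hk
    have hk0 : k 0 = m := by by_contra h; exact hk (if_neg h)
    exact ⟨k 1, by ext i; fin_cases i <;> simp [hk0]⟩
  rw [← hinj.tsum_eq hsupp]
  simp only [Matrix.cons_val_zero, if_true]
  rw [← tsum_mul_left]
  exact Summable.tsum_le_tsum hpt (hs.comp_injective hinj) (hRs.mul_left _)

omit [Fintype d] in
/-- **The bulk bound**: a twisted axis average of a field bounded by `M` is bounded by `M` (the fibre measure is a probability).
This is the value of `S_m` used on the bulk `|m| ≈ γ²`, where no decay is available. [folklore] -/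
theorem norm_twistedAxisAvg_le_of_norm_le {v : UnitAddTorus d → ℂ} {M : ℝ} (hM : ∀ y, ‖v y‖ ≤ M) (i : d) (m : ℤ)
    (x : UnitAddTorus d) : ‖∫ s : UnitAddCircle, (fourier (-m) s : ℂ) • v (x + Pi.single i s)‖ ≤ M := by
  refine (norm_integral_le_integral_norm _).trans ?_
  have h1 : ∀ s : UnitAddCircle, ‖(fourier (-m) s : ℂ) • v (x + Pi.single i s)‖ ≤ M := fun s => by
    have hf : ‖(fourier (-m) s : ℂ)‖ = 1 := by rw [fourier_apply]; exact Circle.norm_coe _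
    rw [norm_smul, hf, one_mul]; exact hM _
  refine (integral_mono_of_nonneg (Eventually.of_forall fun s => norm_nonneg _) (integrable_const M)
    (Eventually.of_forall h1)).trans ?_
  simp

end Summit.AnomalousDissipation.AnomalousDissipation.Theorems.SawtoothPulseCascade.K1Start
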